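import Summits.RiemannHypothesis.RiemannHypothesis.Theses.WeilParity
import Summits.RiemannHypothesis.RiemannHypothesis.Theorems.WeilParityEvenWinsBeyondArchSplit
import Summits.RiemannHypothesis.RiemannHypothesis.Theorems.WeilParityEvenWinsArch

/-!
# `EvenWinsBeyondArch` (crux stmt-RiemannHypothesis-15432, route WeilParity) — what a refutation must be

Negative-side structure lemmas from the standing disprover (refuter-cdisprove-stmt-RiemannHypothesis-15432-0,
cycle 1), all RH-free and sorry-free:

* `not_evenWinsBeyondArch_iff` — negation normal form: the crux fails iff `ε_od(a) < ε_ev(a)` at some `a > (log 2)/2`;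
* `evenWinsBeyondArch_false_of_witness` — KILL CRITERION: one window, ONE odd normalised window test `o` and a
  number `m` with `Re Q(o) < m ≤ Re Q(e)` for all even normalised window tests `e` refute the crux (what a certified
  refutation must produce: an even-sector LOWER bound above one odd Rayleigh quotient);
* `exists_tie_of_not_evenWinsBeyondArch` — ANY counterexample at `a₀` forces an EXACT parity tie `ε_ev(a) = ε_od(a)` at
  some `a ∈ ((log 2)/2, a₀)` (certified anchor + landed sector continuity + IVT), while
  `exists_interval_of_not_evenWinsBeyondArch` — the strict odd win at `a₀` persists on an open interval (continuity), so an
  ORDER scan over windows can detect a counterexample;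
* `evenWinsBeyondArch_false_of_detection_of_not_RH` — RH-STRENGTH, formally: under `¬RH` the crux is false as soon as
  the route's detection crux `OffLineParityDetection` holds (the deciding theorem `closes` rearranged, `EvenWinsArch`
  being a theorem now, p151491);
* `subs_iff_noTie_beyond_arch`, `subs_iff_crux_and_noTie` — the lead's line `split`: its two stubs
  (`OnePrimeWindowSimpleEven`, `NoParityCrossing`) are jointly EQUIVALENT to "no parity tie at any `a > (log 2)/2`",
  i.e. to the crux plus the exclusion of touching ties;
* `noParityCrossing_false_of_detection_of_not_RH` — the hard stub is RH-strength in the same formal sense.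

Axioms: propext, Classical.choice, Quot.sound.
-/

noncomputable section

namespace Summit.RiemannHypothesis.RiemannHypothesis.Theorems.EvenWinsBeyondArch.Negative

-- `Summit.RiemannHypothesis.RiemannHypothesis.…` repeats a namespace component by design (D-0017 layout).
set_option linter.dupNamespace false

open Set MeasureTheory Filter
open scoped Topology
open Literature.NumberTheory.LFunctions
open Summit.RiemannHypothesis.RiemannHypothesis.Theses.WeilParity
open Summit.RiemannHypothesis.RiemannHypothesis.Theorems
open Summit.RiemannHypothesis.RiemannHypothesis.Theorems.EvenWinsBeyondArch

/-- **Negation normal form**: the crux fails iff at SOME window beyond `(log 2)/2` the odd bottom is strictly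
below the even bottom. [folklore] -/
theorem not_evenWinsBeyondArch_iff :
    ¬ EvenWinsBeyondArch ↔ ∃ a : ℝ, Real.log 2 / 2 < a ∧ weilOddGroundEnergy a < weilEvenGroundEnergy a := by
  rw [evenWinsBeyondArch_iff_forall_le]
  push Not
  rfl

/-- **KILL CRITERION**: a window `a > (log 2)/2`, ONE odd normalised window test `o` and a number `m` with
`Re Q(o) < m` that bounds the whole even normalised sphere of the window from below refute the crux. [folklore] -/
theorem evenWinsBeyondArch_false_of_witness {a m : ℝ} (ha : Real.log 2 / 2 < a) {o : ℝ → ℂ}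
    (ho : IsWeilTest o) (hos : tsupport o ⊆ Icc (-a) a) (hodd : ∀ t, o (-t) = -o t)
    (hon : ∫ t, ‖o t‖ ^ 2 = (1 : ℝ)) (hlt : (weilQuadratic o).re < m)
    (hm : ∀ e : ℝ → ℂ, IsWeilTest e → tsupport e ⊆ Icc (-a) a → (∀ t, e (-t) = e t) →
      ∫ t, ‖e t‖ ^ 2 = (1 : ℝ) → m ≤ (weilQuadratic e).re) :
    ¬ EvenWinsBeyondArch := by
  rw [not_evenWinsBeyondArch_iff]
  refine ⟨a, ha, ?_⟩
  have h1 : weilOddGroundEnergy a ≤ (weilQuadratic o).re := weilOddGroundEnergy_le ho hos hodd hon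
  have h2 : m ≤ weilEvenGroundEnergy a :=
    le_weilEvenGroundEnergy_of_forall (log_two_half_pos.trans ha) fun e he hes hev hen ↦ hm e he hes hev hen
  linarith

/-- **Any counterexample is an exact parity tie beyond the archimedean window** (contrapositive of the landed
`evenWinsBeyondArch_of_noCrossing_beyond_arch`: certified order at `(log 2)/2`, continuity, IVT). [folklore] -/
theorem exists_tie_of_not_evenWinsBeyondArch (h : ¬ EvenWinsBeyondArch) :
    ∃ a : ℝ, Real.log 2 / 2 < a ∧ weilEvenGroundEnergy a = weilOddGroundEnergy a := by
  by_contra hne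
  push Not at hne
  exact h (evenWinsBeyondArch_of_noCrossing_beyond_arch hne)

/-- **The counterexample window is robust**: a failure at `a₀` is a strict inequality between functions continuous at
`a₀` (landed `stub_sectorContinuity_continuousAt_even/odd`), hence an open interval of strict odd wins. [folklore] -/
theorem exists_interval_of_not_evenWinsBeyondArch (h : ¬ EvenWinsBeyondArch) :
    ∃ a₀ : ℝ, Real.log 2 / 2 < a₀ ∧ ∃ η : ℝ, 0 < η ∧ ∀ a : ℝ, dist a a₀ < η →
      weilOddGroundEnergy a < weilEvenGroundEnergy a := by
  obtain ⟨a₀, ha₀, hlt⟩ := not_evenWinsBeyondArch_iff.1 h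
  have h0 : 0 < a₀ := log_two_half_pos.trans ha₀
  have hev : ContinuousAt weilEvenGroundEnergy a₀ := stub_sectorContinuity_continuousAt_even h0
  have hod : ContinuousAt weilOddGroundEnergy a₀ := stub_sectorContinuity_continuousAt_odd h0
  obtain ⟨η, hη, hI⟩ := Metric.eventually_nhds_iff.1 (Filter.Tendsto.eventually_lt hod hev hlt)
  exact ⟨a₀, ha₀, η, hη, fun a ha ↦ hI ha⟩

/-- **RH-strength, formally.** Under `¬RH` the crux is FALSE as soon as the route's detection crux
`OffLineParityDetection` holds (the deciding theorem `closes` with `EvenWinsArch` discharged by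
`evenWinsArch_proof`).  Hence: no RH-free proof of the crux unless crux #2 fails; no unconditional refutation
unless RH fails. [folklore] -/
theorem evenWinsBeyondArch_false_of_detection_of_not_RH (hdet : OffLineParityDetection)
    (hRH : ¬ _root_.Summit.RiemannHypothesis) : ¬ EvenWinsBeyondArch :=
  fun h ↦ hRH (closes WeilParity.evenWinsArch_proof h hdet)

/-- **Line `split`: the two stubs are jointly EQUIVALENT to "no parity tie at any `a > (log 2)/2`"**
(landed calibration `forall_weilWindowSimpleEven_iff_subs`, `weilWindowSimpleEven_iff_weilEvenGroundEnergy_lt`,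
anchor propagation `weilEvenGroundEnergy_lt_weilOddGroundEnergy_of_anchor`). [folklore] -/
theorem subs_iff_noTie_beyond_arch :
    (OnePrimeWindowSimpleEven ∧ NoParityCrossing) ↔
      ∀ a : ℝ, Real.log 2 / 2 < a → weilEvenGroundEnergy a ≠ weilOddGroundEnergy a := by
  rw [← forall_weilWindowSimpleEven_iff_subs]
  constructor
  · intro h a ha
    exact ((weilWindowSimpleEven_iff_weilEvenGroundEnergy_lt (log_two_half_pos.trans ha)).1 (h a ha)).ne
  · intro hne a ha
    exact (weilWindowSimpleEven_iff_weilEvenGroundEnergy_lt (log_two_half_pos.trans ha)).2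
      (weilEvenGroundEnergy_lt_weilOddGroundEnergy_of_anchor log_two_half_pos
        weilEvenGroundEnergy_lt_weilOddGroundEnergy_log_two_half hne ha)

/-- **The gap between the line and the crux is exactly "touching ties"**: stubs ↔ (crux ∧ no tie beyond
`(log 2)/2`).  A window where the two sector bottoms touch without crossing satisfies the crux and kills the
line. [folklore] -/
theorem subs_iff_crux_and_noTie :
    (OnePrimeWindowSimpleEven ∧ NoParityCrossing) ↔
      (EvenWinsBeyondArch ∧ ∀ a : ℝ, Real.log 2 / 2 < a → weilEvenGroundEnergy a ≠ weilOddGroundEnergy a) := by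
  rw [subs_iff_noTie_beyond_arch]
  exact ⟨fun h ↦ ⟨evenWinsBeyondArch_of_noCrossing_beyond_arch h, h⟩, fun h ↦ h.2⟩

/-- **The hard stub `NoParityCrossing` is RH-strength**: under `¬RH`, detection and the RH-free one-prime stub
make it false. [folklore] -/
theorem noParityCrossing_false_of_detection_of_not_RH (hdet : OffLineParityDetection)
    (hRH : ¬ _root_.Summit.RiemannHypothesis) (h₁ : OnePrimeWindowSimpleEven) : ¬ NoParityCrossing :=
  fun h₂ ↦ evenWinsBeyondArch_false_of_detection_of_not_RH hdet hRH (evenWinsBeyondArch_of_subs h₁ h₂)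

end Summit.RiemannHypothesis.RiemannHypothesis.Theorems.EvenWinsBeyondArch.Negative

end
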